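import Literature.Probability.RandomPlanarGeometry.Curve
import Literature.Topology.PlaneTopology.AnnulusArcs
import Mathlib.Analysis.Complex.Basic
import Mathlib.Analysis.Convex.Segment
import Mathlib.Analysis.Convex.Topology
import Mathlib.Topology.MetricSpace.HausdorffDistance
import HarnessLib

/-!
# `PathUpgradeR`, line `bidir_windows`, the lead's stub `stub_returnsDie` — part 1a: the deterministic CORE (helpers, coarse IVT)
(crux stmt-CriticalPhenomena-18055, route `SAWReversalUpgrade`)

Purely metric/order-theoretic endgame of the "returns die" argument.  A simple curve `X : Curve ℂ`; its
initial segments are `Xf '' Icc 0 t` (forward capacity `t`) and are `ε`-shadowed by a reference curve `r`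
("forward levels" = times of `r`); its final segments are `Xb '' Icc 0 t'` (backward capacity) and are
`ε'`-shadowed by `r'` ("backward levels").  Given, as HYPOTHESES, the conclusions of the forward and backward
Flank Lemmas (`stub_flank`) and of the compatibility lemma (`stub_compat`), plus window facts, a level
DRAWDOWN (an earlier point at forward level `β`, a later point at level `α ≤ β - 9 c₀`, both far from `a`, `b`)
is contradictory (`PathUpgradeRCore.endgame`): take a point `x₀` of the arc at the mid level, a far point `e`
(porosity), the point `p` of `X ∩ segment x₀ e` closest to `e`; if `p` is laid after the high point it is
forward-sub-front and the forward Flank Lemma produces an EARLIER point of `X` strictly between `p` and `e`; if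
before, the later low point makes it backward-sub-front (compatibility) and the backward Flank Lemma produces a
LATER point strictly between `p` and `e` — either way contradicting the choice of `p`.  An `(ℓ, ε)`-return forces
a drawdown (`PathUpgradeRCore.no_return`).  [folklore]
-/

noncomputable section

open Set Metric Filter Topology
open scoped unitInterval NNReal

namespace Summit.CriticalPhenomena.SAWScalingLimit.Theorems.PathUpgradeRCore

open Literature.Probability.RandomPlanarGeometry

/-! ### Small metric helpers -/

/-- A point of a compact set `A` with `hausdorffDist A B ≤ ε` (for `B` compact nonempty) has an `ε`-close point
in `B`. [folklore] -/
theorem exists_mem_dist_le_of_hausdorffDist_le {A B : Set ℂ} (hA : IsCompact A) (hB : IsCompact B)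
    (hBne : B.Nonempty) {ε : ℝ} (h : hausdorffDist A B ≤ ε) {x : ℂ} (hx : x ∈ A) :
    ∃ y ∈ B, dist x y ≤ ε := by
  have hAne : A.Nonempty := ⟨x, hx⟩
  have hfin : Metric.hausdorffEDist A B ≠ ⊤ :=
    hausdorffEDist_ne_top_of_nonempty_of_bounded hAne hBne hA.isBounded hB.isBounded
  obtain ⟨y, hy, hxy⟩ := hB.exists_infDist_eq_dist hBne x
  refine ⟨y, hy, ?_⟩
  rw [← hxy]
  exact (infDist_le_hausdorffDist_of_mem hx hfin).trans h

/-- Symmetric form of `exists_mem_dist_le_of_hausdorffDist_le`. [folklore] -/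
theorem exists_mem_dist_le_of_hausdorffDist_le' {A B : Set ℂ} (hA : IsCompact A) (hB : IsCompact B)
    (hAne : A.Nonempty) {ε : ℝ} (h : hausdorffDist A B ≤ ε) {y : ℂ} (hy : y ∈ B) :
    ∃ x ∈ A, dist x y ≤ ε := by
  rw [hausdorffDist_comm] at h
  obtain ⟨x, hx, hxy⟩ := exists_mem_dist_le_of_hausdorffDist_le hB hA hAne h hy
  exact ⟨x, hx, by rwa [dist_comm]⟩

/-- WITNESS COMPARISON: two level witnesses (radii `R`, `R'`) of points at distance `≤ δ` differ by `< w` as soon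
as `R + R' + δ < μ`, `μ` being the injectivity modulus of the reference at scale `w`. [folklore] -/
theorem abs_sub_lt_of_witness {r : ℝ≥0 → ℂ} {T : ℝ≥0} {w μ : ℝ}
    (hinj : ∀ s t : ℝ≥0, (s : ℝ) ≤ T + 1 → (t : ℝ) ≤ T + 1 → w ≤ |(s : ℝ) - t| → μ ≤ dist (r s) (r t))
    {y y' : ℂ} {u u' : ℝ≥0} {R R' δ : ℝ} (hu : (u : ℝ) ≤ T + 1) (hu' : (u' : ℝ) ≤ T + 1)
    (hy : dist y (r u) ≤ R) (hy' : dist y' (r u') ≤ R') (hyy' : dist y y' ≤ δ) (hsum : R + R' + δ < μ) :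
    |(u : ℝ) - u'| < w := by
  by_contra hle
  push Not at hle
  have h1 := hinj u u' hu hu' hle
  have h2 : dist (r u) (r u') ≤ R + δ + R' := by
    calc dist (r u) (r u') ≤ dist (r u) y + dist y y' + dist y' (r u') := dist_triangle4 _ _ _ _
      _ ≤ R + δ + R' := by rw [dist_comm (r u) y]; exact add_le_add_three hy hyy' hy'
  linarith

/-! ### Segment helpers -/

/-- `segment p e ⊆ segment x e` for `p ∈ segment x e`. [folklore] -/
theorem segment_subset_segment_of_mem {x e p : ℂ} (hp : p ∈ segment ℝ x e) :
    segment ℝ p e ⊆ segment ℝ x e :=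
  (convex_segment x e).segment_subset hp (right_mem_segment ℝ x e)

/-! ### Coarse intermediate values of levels along the curve -/

/-- The set of (time, witness) pairs over a time interval with witnesses in a closed real range is compact.
[folklore] -/
theorem isCompact_witnessPairs (X : Curve ℂ) {r : ℝ≥0 → ℂ} (hr : Continuous r) (v₁ v₂ : I) (T : ℝ≥0)
    (ε lo hi : ℝ) :
    IsCompact {p : I × ℝ≥0 | p.1 ∈ Icc v₁ v₂ ∧ p.2 ∈ Icc (0 : ℝ≥0) (T + 1) ∧
      dist (X p.1) (r p.2) ≤ ε ∧ lo ≤ (p.2 : ℝ) ∧ (p.2 : ℝ) ≤ hi} := by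
  have hK : IsCompact ((Icc v₁ v₂) ×ˢ (Icc (0 : ℝ≥0) (T + 1))) := isCompact_Icc.prod isCompact_Icc
  have hc : Continuous fun p : I × ℝ≥0 => dist (X p.1) (r p.2) :=
    (X.continuous.comp continuous_fst).dist (hr.comp continuous_snd)
  have hc2 : Continuous fun p : I × ℝ≥0 => ((p.2 : ℝ≥0) : ℝ) :=
    NNReal.continuous_coe.comp continuous_snd
  have hcl : IsClosed {p : I × ℝ≥0 | dist (X p.1) (r p.2) ≤ ε ∧ lo ≤ (p.2 : ℝ) ∧ (p.2 : ℝ) ≤ hi} :=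
    (isClosed_le hc continuous_const).inter
      ((isClosed_le continuous_const hc2).inter (isClosed_le hc2 continuous_const))
  have hEq : {p : I × ℝ≥0 | p.1 ∈ Icc v₁ v₂ ∧ p.2 ∈ Icc (0 : ℝ≥0) (T + 1) ∧
      dist (X p.1) (r p.2) ≤ ε ∧ lo ≤ (p.2 : ℝ) ∧ (p.2 : ℝ) ≤ hi} =
      ((Icc v₁ v₂) ×ˢ (Icc (0 : ℝ≥0) (T + 1))) ∩
        {p : I × ℝ≥0 | dist (X p.1) (r p.2) ≤ ε ∧ lo ≤ (p.2 : ℝ) ∧ (p.2 : ℝ) ≤ hi} := by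
    ext p
    simp only [mem_setOf_eq, mem_inter_iff, mem_prod]
    tauto
  rw [hEq]
  exact hK.inter_right hcl

/-- COARSE INTERMEDIATE VALUE: if along `[v₁, v₂]` every point of `X` has an `ε`-witness in `[0, T+1]`, the point
`X v₁` has a witness `≥ x⋆` and `X v₂` has a witness `≤ x⋆ - w`, then some `X v`, `v ∈ [v₁, v₂]`, has a witness in
`[x⋆, x⋆ + w)` (two witnesses of one point differ by `< w` when `2ε < μ`). [folklore] -/
theorem exists_witness_near_level (X : Curve ℂ) {r : ℝ≥0 → ℂ} (hr : Continuous r) {T : ℝ≥0} {ε w μ : ℝ}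
    (hinj : ∀ s t : ℝ≥0, (s : ℝ) ≤ T + 1 → (t : ℝ) ≤ T + 1 → w ≤ |(s : ℝ) - t| → μ ≤ dist (r s) (r t))
    (hεμ : ε + ε < μ) {v₁ v₂ : I} (h12 : v₁ ≤ v₂)
    (hwit : ∀ v ∈ Icc v₁ v₂, ∃ u : ℝ≥0, (u : ℝ) ≤ T + 1 ∧ dist (X v) (r u) ≤ ε)
    {xs : ℝ} {u₁ u₂ : ℝ≥0} (hu₁T : (u₁ : ℝ) ≤ T + 1) (hu₁ : dist (X v₁) (r u₁) ≤ ε) (hx₁ : xs ≤ u₁)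
    (hu₂T : (u₂ : ℝ) ≤ T + 1) (hu₂ : dist (X v₂) (r u₂) ≤ ε) (hx₂ : (u₂ : ℝ) + w ≤ xs) :
    ∃ v ∈ Icc v₁ v₂, ∃ u : ℝ≥0, (u : ℝ) ≤ T + 1 ∧ dist (X v) (r u) ≤ ε ∧ xs ≤ u ∧ (u : ℝ) < xs + w := by
  -- the compact set of times carrying a witness `≥ xs`, and its maximum `vs`
  set K : Set (I × ℝ≥0) := {p | p.1 ∈ Icc v₁ v₂ ∧ p.2 ∈ Icc (0 : ℝ≥0) (T + 1) ∧
      dist (X p.1) (r p.2) ≤ ε ∧ xs ≤ (p.2 : ℝ) ∧ (p.2 : ℝ) ≤ T + 1} with hK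
  have hKc : IsCompact K := isCompact_witnessPairs X hr v₁ v₂ T ε xs (T + 1)
  set S : Set I := Prod.fst '' K with hS
  have hSc : IsCompact S := hKc.image continuous_fst
  have hu₁I : u₁ ∈ Icc (0 : ℝ≥0) (T + 1) := ⟨bot_le, by exact_mod_cast hu₁T⟩
  have hv₁S : v₁ ∈ S := ⟨(v₁, u₁), ⟨⟨le_rfl, h12⟩, hu₁I, hu₁, hx₁, hu₁T⟩, rfl⟩
  have hSne : S.Nonempty := ⟨v₁, hv₁S⟩
  obtain ⟨vs, hvsS, hvsmax⟩ := hSc.exists_isMaxOn hSne continuous_id.continuousOn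
  obtain ⟨⟨vs', ua⟩, ⟨hvs12, -, hua, hxua, huaT⟩, hvs'⟩ := hvsS
  simp only at hvs'
  subst hvs'
  -- `vs < v₂`
  have hvs2 : vs' < v₂ := by
    rcases hvs12.2.lt_or_eq with h | h
    · exact h
    · exfalso
      rw [h] at hua
      have := abs_sub_lt_of_witness hinj huaT hu₂T hua hu₂ (le_of_eq (dist_self _)) (by linarith)
      rw [abs_lt] at this
      have h' : (xs : ℝ) ≤ ua := hxua
      linarith [this.1]
  -- every time in `(vs, v₂]` carries only witnesses `< xs`, hence a witness `≤ xs`; pass to the limit at `vs`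
  set S₃ : Set I := Prod.fst '' {p : I × ℝ≥0 | p.1 ∈ Icc v₁ v₂ ∧ p.2 ∈ Icc (0 : ℝ≥0) (T + 1) ∧
      dist (X p.1) (r p.2) ≤ ε ∧ 0 ≤ (p.2 : ℝ) ∧ (p.2 : ℝ) ≤ xs} with hS₃
  have hS₃c : IsClosed S₃ := ((isCompact_witnessPairs X hr v₁ v₂ T ε 0 xs).image continuous_fst).isClosed
  have hIoc : Ioc vs' v₂ ⊆ S₃ := by
    intro v hv
    have hv12 : v ∈ Icc v₁ v₂ := ⟨hvs12.1.trans hv.1.le, hv.2⟩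
    obtain ⟨u, huT, hu⟩ := hwit v hv12
    have huxs : (u : ℝ) ≤ xs := by
      by_contra hlt
      push Not at hlt
      have hvS : v ∈ S := ⟨(v, u), ⟨hv12, ⟨bot_le, by exact_mod_cast huT⟩, hu, hlt.le, huT⟩, rfl⟩
      have := hvsmax hvS
      simp only [id_eq] at this
      exact absurd this (not_le.2 hv.1)
    exact ⟨(v, u), ⟨hv12, ⟨bot_le, by exact_mod_cast huT⟩, hu, u.2, huxs⟩, rfl⟩
  have hvsS₃ : vs' ∈ S₃ := by
    have hcl : vs' ∈ closure (Ioc vs' v₂) := by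
      rw [closure_Ioc hvs2.ne]
      exact ⟨le_rfl, hvs2.le⟩
    exact hS₃c.closure_subset_iff.2 hIoc hcl
  obtain ⟨⟨vs'', ub⟩, ⟨-, -, hub, -, hubxs⟩, hvs''⟩ := hvsS₃
  simp only at hvs''
  subst hvs''
  have hubT : (ub : ℝ) ≤ T + 1 := by
    have h' : (xs : ℝ) ≤ ua := hxua
    linarith
  have hab := abs_sub_lt_of_witness hinj huaT hubT hua hub (le_of_eq (dist_self _)) (by linarith)
  rw [abs_lt] at hab
  exact ⟨vs'', hvs12, ua, huaT, hua, hxua, by linarith [hab.2]⟩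

end Summit.CriticalPhenomena.SAWScalingLimit.Theorems.PathUpgradeRCore

namespace Summit.CriticalPhenomena.SAWScalingLimit.Theorems

/-- Registered auxiliary stub `stub_returnsDie_coreA` of crux stmt-CriticalPhenomena-18055 (line `bidir_windows`): the
coarse intermediate-value principle for reference levels along the curve (`PathUpgradeRCore.exists_witness_near_level`).
[folklore] -/
theorem stub_returnsDie_coreA : ∀ (X : Literature.Probability.RandomPlanarGeometry.Curve ℂ) (r : NNReal → ℂ), Continuous r → ∀ (T : NNReal) (ε w μ : ℝ), (∀ s t : NNReal, (s : ℝ) ≤ T + 1 → (t : ℝ) ≤ T + 1 → w ≤ |(s : ℝ) - t| → μ ≤ dist (r s) (r t)) → ε + ε < μ → ∀ (v₁ v₂ : unitInterval), v₁ ≤ v₂ → (∀ v ∈ Set.Icc v₁ v₂, ∃ u : NNReal, (u : ℝ) ≤ T + 1 ∧ dist (X v) (r u) ≤ ε) → ∀ (xs : ℝ) (u₁ u₂ : NNReal), (u₁ : ℝ) ≤ T + 1 → dist (X v₁) (r u₁) ≤ ε → xs ≤ u₁ → (u₂ : ℝ) ≤ T + 1 → dist (X v₂) (r u₂) ≤ ε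 → (u₂ : ℝ) + w ≤ xs → ∃ v ∈ Set.Icc v₁ v₂, ∃ u : NNReal, (u : ℝ) ≤ T + 1 ∧ dist (X v) (r u) ≤ ε ∧ xs ≤ u ∧ (u : ℝ) < xs + w :=
  fun X _ hr _ _ _ _ hinj hεμ _ _ h12 hwit _ _ _ hu₁T hu₁ hx₁ hu₂T hu₂ hx₂ =>
    PathUpgradeRCore.exists_witness_near_level X hr hinj hεμ h12 hwit hu₁T hu₁ hx₁ hu₂T hu₂ hx₂

end Summit.CriticalPhenomena.SAWScalingLimit.Theorems

end
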